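import Literature.NumberTheory.Automorphic.ArchRankOneLimitFormulaThirdJet            -- ★ Z4 p844064: `exists_jets_orbitalIntegral`, `exists_eventually_norm_le_of_tendsto_deriv`
import HarnessLib

/-!
# Third jets of `m(s)·F(s)` at `0` from the rank-one jet package, for a smooth factor `m` with `m′(0) = m‴(0) = 0` (one-variable Leibniz step of the road (Z) descent)

Topic `NumberTheory/Automorphic`; namespace `Literature.NumberTheory.Automorphic.RankOneCasimir`.  THEOREMS ONLY (no `def`, no instance, no notation, no axiom, no named
fact, no `sorry`).  Cell `pub/hodgecm-mathlib`, ENGINE T1 (crux H413 = `stmt-HodgeConjecture-24833`); ROAD (Z) toward the row (J3-odd)₃ = [Varadarajan1989 §6.4 Thm 24, `r = 1`]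
descended (census `CENSUS-J3odd3-InHouse.A-p18g25.md` 7db511ac), FILE Z5 (a) of the pair Z5 (a)∕(b), over ★ Z4 `ArchRankOneLimitFormulaThirdJet`.  Author A-p18 (g26), 2026-09-01.

WHY.  Along the normal line `s ↦ ζe^{i(tA′+sN′)}` through a semiregular point of the noncompact wall `θ₀ = θ₂` of `U(2,1)`, the letter's `F_Θ = ρ′Δ·Φ_Θ` reads, for `0 < |s| < δ`,
`F_Θ(s) = m(s) · F_{f♭}(s)` with `F_{f♭}` the normalised rank-one orbital integral of ★ (R1G)∕★ Z4 on the block group `U(e₀,e₂)` and the SMOOTH EVEN factor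
`m(s) = c₀ · i(2cos s − 2cos 3t)` (★ `rhoWeylDelta_angleChart_wall02_line`: `ρ′Δ = 2 sin s · i(2cos s − 2cos 3t)`; ★ (d3a): `Φ_Θ = c₀ · Orb_{G₂}(f♭)`).  ★ Z4 gives the jets of `F = F_{f♭}`:
`F′ → L₁`, `G′ → L₁′` (`G = F_{Ωf♭}`), `(F′)′ = −(F + G)` on `0 < |ψ| < 1`, hence `F`, `G` bounded near `0` (★ `exists_eventually_norm_le_of_tendsto_deriv`) although `F` itself JUMPS at `0`.
Leibniz: `(mF)‴ = m‴F + 3m″F′ + 3m′F″ + mF‴ = m‴F + 3m″F′ − 3m′(F + G) − m(F′ + G′)`; the jump terms carry the factors `m′ → 0`, `m‴ → 0`, so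
**`(mF)‴ → 3m″(0)·L₁ − m(0)·(L₁ + L₁′)`** along `𝓝[≠] 0` — a TWO-SIDED limit.

WHAT IS PROVED.
* §1 **`tendsto_iteratedDeriv_three_mul_of_jets`** — the statement above for `F, G : ℝ → ℂ` with ★ Z4's jet package as hypotheses and any `m` with three everywhere-`HasDerivAt` jets
  `m₁, m₂, m₃`, `m₁ → 0` and `m₃ → 0` at `0` (the three `deriv`s of `s ↦ m s * F s` are computed pointwise on the open set `0 < |ψ| < 1` by `HasDerivAt.mul` and propagated with
  `Filter.EventuallyEq`; `Filter.Tendsto.zero_mul_isBoundedUnder_le` kills the jump terms).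
* §2 **`hasDerivAt_evenFactor`** ∕ **`tendsto_iteratedDeriv_three_evenFactor_mul`** — the jets of `m(s) = c · (i·(2cos s − 2cos 3t))` (`m′ = c·i·(−2 sin s)`, `m″ = c·i·(−2cos s)`,
  `m‴ = c·i·(2 sin s)`) and the resulting two-sided limit `∃ Lim, (m·F)‴ → Lim` for every `F` carrying the jet package.
HONEST LABEL: one-variable calculus; pays nothing by itself (HC_CM is proved only modulo the printed citations until rung 0 closes).

## References
* [Varadarajan1989] V. S. Varadarajan, *An Introduction to Harmonic Analysis on Semisimple Lie Groups* (1989), §6.4 Thm 24 (odd derivatives of `F_f` continuous at `0`).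
* [Rogawski1990] J. D. Rogawski, *Automorphic Representations of Unitary Groups in Three Variables*, Ann. of Math. Stud. 123 (1990), §8.4 p. 126 (`∂(H³)F_Θ` across the noncompact wall).
-/

set_option autoImplicit false

namespace Literature.NumberTheory.Automorphic.RankOneCasimir

open _root_.Complex _root_.Set _root_.Filter _root_.Topology

/-! ## §1 The generic Leibniz step -/

/-- **`(m·F)‴ → 3m″(0)L₁ − m(0)(L₁ + L₁′)` along `𝓝[≠] 0`** for `F, G : ℝ → ℂ` carrying ★ Z4's jet package (`F′ → L₁`, `G′ → L₁′`, and on `0 < |ψ| < 1`: `F, G` differentiable,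
`(F′)′ = −(F + G)`) and a factor `m` with everywhere-defined jets `m₁, m₂, m₃` (`HasDerivAt`), `m₁ → 0`, `m₃ → 0` at `0`.  The one-sided jumps of `F` and `F″ = −(F+G)` at `0` are
multiplied by `m‴ → 0`, `m′ → 0` (boundedness of `F`, `G` near `0`: ★ `exists_eventually_norm_le_of_tendsto_deriv`). [cite: Varadarajan1989, §6.4 Thm 24] [cite: Rogawski1990, §8.4 p. 126] -/
theorem tendsto_iteratedDeriv_three_mul_of_jets {F G : ℝ → ℂ} {L₁ L₁' : ℂ}
    (hF1 : Tendsto (fun ψ : ℝ => deriv F ψ) (𝓝[≠] 0) (𝓝 L₁)) (hG1 : Tendsto (fun ψ : ℝ => deriv G ψ) (𝓝[≠] 0) (𝓝 L₁'))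
    (hjet : ∀ ψ ∈ Ioo (-1 : ℝ) 1, ψ ≠ 0 → HasDerivAt F (deriv F ψ) ψ ∧ HasDerivAt G (deriv G ψ) ψ ∧ HasDerivAt (deriv F) (-(F ψ + G ψ)) ψ)
    {m m₁ m₂ m₃ : ℝ → ℂ} (hm : ∀ y : ℝ, HasDerivAt m (m₁ y) y) (hm₁ : ∀ y : ℝ, HasDerivAt m₁ (m₂ y) y) (hm₂ : ∀ y : ℝ, HasDerivAt m₂ (m₃ y) y)
    (hm₁0 : Tendsto m₁ (𝓝 0) (𝓝 0)) (hm₃0 : Tendsto m₃ (𝓝 0) (𝓝 0)) :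
    Tendsto (fun ψ : ℝ => iteratedDeriv 3 (fun s : ℝ => m s * F s) ψ) (𝓝[≠] 0) (𝓝 (3 * m₂ 0 * L₁ - m 0 * (L₁ + L₁'))) := by
  -- boundedness of `F`, `G` near `0`
  obtain ⟨BF, hBF⟩ := exists_eventually_norm_le_of_tendsto_deriv (E := ℂ) (fun ψ hψ hψ0 => (hjet ψ hψ hψ0).1.differentiableAt) hF1
  obtain ⟨BG, hBG⟩ := exists_eventually_norm_le_of_tendsto_deriv (E := ℂ) (fun ψ hψ hψ0 => (hjet ψ hψ hψ0).2.1.differentiableAt) hG1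
  have hBFG : ∀ᶠ ψ in 𝓝[≠] (0 : ℝ), ‖-(F ψ + G ψ)‖ ≤ BF + BG := by
    filter_upwards [hBF, hBG] with ψ h1 h2
    rw [norm_neg]; exact (norm_add_le _ _).trans (add_le_add h1 h2)
  -- the first three derivatives of `m·F`, pointwise on `0 < |ψ| < 1`
  have hnhds : ∀ ψ ∈ Ioo (-1 : ℝ) 1, ψ ≠ 0 → ∀ᶠ y in 𝓝 ψ, y ∈ Ioo (-1 : ℝ) 1 ∧ y ≠ 0 := fun ψ hψ hψ0 => by
    filter_upwards [isOpen_Ioo.mem_nhds hψ, isOpen_ne.mem_nhds hψ0] with y hy hy0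
    exact ⟨hy, hy0⟩
  have hD1 : ∀ ψ ∈ Ioo (-1 : ℝ) 1, ψ ≠ 0 → HasDerivAt (fun s : ℝ => m s * F s) (m₁ ψ * F ψ + m ψ * deriv F ψ) ψ := fun ψ hψ hψ0 =>
    (hm ψ).mul (hjet ψ hψ hψ0).1
  have hD2 : ∀ ψ ∈ Ioo (-1 : ℝ) 1, ψ ≠ 0 → HasDerivAt (deriv fun s : ℝ => m s * F s)
      ((m₂ ψ * F ψ + m₁ ψ * deriv F ψ) + (m₁ ψ * deriv F ψ + m ψ * (-(F ψ + G ψ)))) ψ := fun ψ hψ hψ0 => by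
    have h : HasDerivAt (fun y : ℝ => m₁ y * F y + m y * deriv F y) ((m₂ ψ * F ψ + m₁ ψ * deriv F ψ) + (m₁ ψ * deriv F ψ + m ψ * (-(F ψ + G ψ)))) ψ :=
      ((hm₁ ψ).mul (hjet ψ hψ hψ0).1).add ((hm ψ).mul (hjet ψ hψ hψ0).2.2)
    refine h.congr_of_eventuallyEq ?_
    filter_upwards [hnhds ψ hψ hψ0] with y hy
    exact (hD1 y hy.1 hy.2).deriv
  have hD3 : ∀ ψ ∈ Ioo (-1 : ℝ) 1, ψ ≠ 0 → HasDerivAt (deriv (deriv fun s : ℝ => m s * F s))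
      (((m₃ ψ * F ψ + m₂ ψ * deriv F ψ) + (m₂ ψ * deriv F ψ + m₁ ψ * (-(F ψ + G ψ)))) +
        ((m₂ ψ * deriv F ψ + m₁ ψ * (-(F ψ + G ψ))) + (m₁ ψ * (-(F ψ + G ψ)) + m ψ * (-(deriv F ψ + deriv G ψ))))) ψ := fun ψ hψ hψ0 => by
    have hFG : HasDerivAt (fun y : ℝ => -(F y + G y)) (-(deriv F ψ + deriv G ψ)) ψ := ((hjet ψ hψ hψ0).1.add (hjet ψ hψ hψ0).2.1).neg
    have h : HasDerivAt (fun y : ℝ => (m₂ y * F y + m₁ y * deriv F y) + (m₁ y * deriv F y + m y * (-(F y + G y))))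
        (((m₃ ψ * F ψ + m₂ ψ * deriv F ψ) + (m₂ ψ * deriv F ψ + m₁ ψ * (-(F ψ + G ψ)))) +
          ((m₂ ψ * deriv F ψ + m₁ ψ * (-(F ψ + G ψ))) + (m₁ ψ * (-(F ψ + G ψ)) + m ψ * (-(deriv F ψ + deriv G ψ))))) ψ :=
      (((hm₂ ψ).mul (hjet ψ hψ hψ0).1).add ((hm₁ ψ).mul (hjet ψ hψ hψ0).2.2)).add
        (((hm₁ ψ).mul (hjet ψ hψ hψ0).2.2).add ((hm ψ).mul hFG))
    refine h.congr_of_eventuallyEq ?_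
    filter_upwards [hnhds ψ hψ hψ0] with y hy
    exact (hD2 y hy.1 hy.2).deriv
  have hd3 : ∀ ψ ∈ Ioo (-1 : ℝ) 1, ψ ≠ 0 → iteratedDeriv 3 (fun s : ℝ => m s * F s) ψ =
      ((m₃ ψ * F ψ + m₂ ψ * deriv F ψ) + (m₂ ψ * deriv F ψ + m₁ ψ * (-(F ψ + G ψ)))) +
        ((m₂ ψ * deriv F ψ + m₁ ψ * (-(F ψ + G ψ))) + (m₁ ψ * (-(F ψ + G ψ)) + m ψ * (-(deriv F ψ + deriv G ψ)))) := fun ψ hψ hψ0 => by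
    rw [iteratedDeriv_succ, iteratedDeriv_succ, iteratedDeriv_one]
    exact (hD3 ψ hψ hψ0).deriv
  -- the limits of the eight terms
  have hm0 : Tendsto m (𝓝[≠] 0) (𝓝 (m 0)) := (hm 0).continuousAt.tendsto.mono_left nhdsWithin_le_nhds
  have hm2 : Tendsto m₂ (𝓝[≠] 0) (𝓝 (m₂ 0)) := (hm₂ 0).continuousAt.tendsto.mono_left nhdsWithin_le_nhds
  have hm1 : Tendsto m₁ (𝓝[≠] 0) (𝓝 0) := hm₁0.mono_left nhdsWithin_le_nhds
  have hm3 : Tendsto m₃ (𝓝[≠] 0) (𝓝 0) := hm₃0.mono_left nhdsWithin_le_nhds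
  have T1 : Tendsto (fun ψ : ℝ => m₃ ψ * F ψ) (𝓝[≠] 0) (𝓝 0) := hm3.zero_mul_isBoundedUnder_le ⟨BF, hBF⟩
  have T2 : Tendsto (fun ψ : ℝ => m₂ ψ * deriv F ψ) (𝓝[≠] 0) (𝓝 (m₂ 0 * L₁)) := hm2.mul hF1
  have T3 : Tendsto (fun ψ : ℝ => m₁ ψ * (-(F ψ + G ψ))) (𝓝[≠] 0) (𝓝 0) := hm1.zero_mul_isBoundedUnder_le ⟨BF + BG, hBFG⟩
  have T4 : Tendsto (fun ψ : ℝ => m ψ * (-(deriv F ψ + deriv G ψ))) (𝓝[≠] 0) (𝓝 (m 0 * (-(L₁ + L₁')))) := hm0.mul (hF1.add hG1).neg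
  have Tall := ((T1.add T2).add (T2.add T3)).add ((T2.add T3).add (T3.add T4))
  have hval : 0 + m₂ 0 * L₁ + (m₂ 0 * L₁ + 0) + (m₂ 0 * L₁ + 0 + (0 + m 0 * (-(L₁ + L₁')))) = 3 * m₂ 0 * L₁ - m 0 * (L₁ + L₁') := by ring
  rw [hval] at Tall
  refine Tall.congr' ?_
  have hmem : Ioo (-1 : ℝ) 1 ∩ {(0 : ℝ)}ᶜ ∈ 𝓝[≠] (0 : ℝ) :=
    inter_mem (mem_nhdsWithin_of_mem_nhds (Ioo_mem_nhds (by norm_num) (by norm_num))) self_mem_nhdsWithin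
  filter_upwards [hmem] with ψ hψ
  exact (hd3 ψ hψ.1 hψ.2).symm

/-! ## §2 The even factor `m(s) = c · i(2cos s − 2cos 3t)` of the noncompact-wall normal line -/

/-- The jets of `m(s) = c·i·(2cos s − 2cos 3t)`: `m′(s) = c·i·(−2 sin s)`, `m″(s) = c·i·(−2cos s)`, `m‴(s) = c·i·(2 sin s)`, everywhere. [cite: Rogawski1990, §8.4 p. 126] -/
theorem hasDerivAt_evenFactor (c : ℂ) (t y : ℝ) :
    HasDerivAt (fun s : ℝ => c * (I * (2 * Real.cos s - 2 * Real.cos (3 * t) : ℂ))) (c * (I * (-2 * Real.sin y : ℂ))) y ∧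
      HasDerivAt (fun s : ℝ => c * (I * (-2 * Real.sin s : ℂ))) (c * (I * (-2 * Real.cos y : ℂ))) y ∧
      HasDerivAt (fun s : ℝ => c * (I * (-2 * Real.cos s : ℂ))) (c * (I * (2 * Real.sin y : ℂ))) y := by
  have hcos : HasDerivAt (fun s : ℝ => (Real.cos s : ℂ)) (-Real.sin y : ℂ) y := by
    have h := (Real.hasDerivAt_cos y).ofReal_comp
    simpa using h
  have hsin : HasDerivAt (fun s : ℝ => (Real.sin s : ℂ)) (Real.cos y : ℂ) y := (Real.hasDerivAt_sin y).ofReal_comp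
  refine ⟨?_, ?_, ?_⟩
  · have h := ((hcos.const_mul (2 : ℂ)).sub_const (2 * Real.cos (3 * t) : ℂ)).const_mul I |>.const_mul c
    exact h.congr_deriv (by ring)
  · have h := (hsin.const_mul (-2 : ℂ)).const_mul I |>.const_mul c
    exact h.congr_deriv (by ring)
  · have h := (hcos.const_mul (-2 : ℂ)).const_mul I |>.const_mul c
    exact h.congr_deriv (by ring)

/-- **THE TWO-SIDED LIMIT OF `(m·F)‴` FOR THE NONCOMPACT-WALL FACTOR**: for `m(s) = c·i·(2cos s − 2cos 3t)` and every `F, G` carrying ★ Z4's jet package,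
`∃ Lim, iteratedDeriv 3 (m·F) → Lim` along `𝓝[≠] 0` (§1 with `m′(0) = m‴(0) = 0`). [cite: Varadarajan1989, §6.4 Thm 24] [cite: Rogawski1990, §8.4 p. 126] -/
theorem exists_tendsto_iteratedDeriv_three_evenFactor_mul (c : ℂ) (t : ℝ) {F G : ℝ → ℂ} {L₁ L₁' : ℂ}
    (hF1 : Tendsto (fun ψ : ℝ => deriv F ψ) (𝓝[≠] 0) (𝓝 L₁)) (hG1 : Tendsto (fun ψ : ℝ => deriv G ψ) (𝓝[≠] 0) (𝓝 L₁'))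
    (hjet : ∀ ψ ∈ Ioo (-1 : ℝ) 1, ψ ≠ 0 → HasDerivAt F (deriv F ψ) ψ ∧ HasDerivAt G (deriv G ψ) ψ ∧ HasDerivAt (deriv F) (-(F ψ + G ψ)) ψ) :
    ∃ Lim : ℂ, Tendsto (fun ψ : ℝ => iteratedDeriv 3 (fun s : ℝ => c * (I * (2 * Real.cos s - 2 * Real.cos (3 * t) : ℂ)) * F s) ψ) (𝓝[≠] 0) (𝓝 Lim) := by
  have h0 : Tendsto (fun s : ℝ => c * (I * (-2 * Real.sin s : ℂ))) (𝓝 0) (𝓝 0) := by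
    have hc : Continuous fun s : ℝ => c * (I * (-2 * Real.sin s : ℂ)) := by fun_prop
    simpa using hc.tendsto 0
  have h3 : Tendsto (fun s : ℝ => c * (I * (2 * Real.sin s : ℂ))) (𝓝 0) (𝓝 0) := by
    have hc : Continuous fun s : ℝ => c * (I * (2 * Real.sin s : ℂ)) := by fun_prop
    simpa using hc.tendsto 0
  exact ⟨_, tendsto_iteratedDeriv_three_mul_of_jets hF1 hG1 hjet (fun y => (hasDerivAt_evenFactor c t y).1)
    (fun y => (hasDerivAt_evenFactor c t y).2.1) (fun y => (hasDerivAt_evenFactor c t y).2.2) h0 h3⟩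

end Literature.NumberTheory.Automorphic.RankOneCasimir
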